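import Summits.QuantumFields.BalabanUV.T4Continuum.Support.NE7MultiplierTailLetter
import Summits.QuantumFields.BalabanUV.T4Continuum.Support.NE7ConstraintSecondDerivativeRecursion
import Literature.MathematicalPhysics.QuantumFieldTheory.Balaban1983to89.B7UnitaryAveragesAllRadii
import Mathlib.Topology.Algebra.Module.Star
import HarnessLib

/-!
# NE7MultiplierTermRecursion — THE MULTIPLIER TERM OF THE BORDERED HESSIAN ALONG THE TOWER: BASE AND STEP.
# `|Dm(0)[D²𝒢_{0,W}(0)[ψ,ψ]]| ≤ 2·curl1C·ε·K·Σ_b‖ψ̃_b‖²` and `|Dm(0)[D²𝒢_{k+1,W}(0)[ψ,ψ]]| ≤ |Dm(0)[D²𝒢_{k,W̄}(0)[Tψ,Tψ]]| + 2·curl1C·ε·‖Q̄_{k+1,W̄}(D²coord_W(0)[ψ,ψ])‖_{ℓ¹(periodBox N)}`,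
# `K = (4∕rho0²)·4·(2·nbRad+1)⁴`, `W̄ = cavg W`, `T = D coord_W(0)` — the (G3) series of ROAD-G116 §6 REDUCED TO THE `ℓ¹` NORMS OF THE STRAIGHT TOWER OF THE ONE-STEP CURVATURES (d = 4, every `U(n)`,
# `L ≥ 2`, every level `j`, every volume `N`; iterate the step down the tower of bases `cavgIter i U♯`)

Cell `pub-balaban`, rung (B)+1 sub-cell t4, lineage `b2b-balaban-t4-ne7b-p1` (row NE7b OWNER + CRUX PROVER; junction service for row NE7, ruling R-OWNER-149-1 (2)), generation 161.
Index `t4/b2b-balaban-t4-ne7b-p1/g161/INDEX.md`; memo `g161/records/SCOPING-G3.md`.  ASSEMBLY of this seat's letters: the tower recursion ✓ `NE7ConstraintSecondDerivativeRecursion` (A),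
the one-step curvature ✓ `NE7OneStepConstraintCurvature` (C), the density ✓ `NE7MultiplierDensity` (E) and the tail letter ✓ `NE7MultiplierTailLetter` (F: the multiplier composed with
`levelQ′_k(W̄)` sees only the straight tower and is `2·curl1C·ε` on it in `ℓ¹`).  §1 supplies the one input F needs of the one-step curvature — it is SKEW (`𝔲(n)`-valued) on skew
directions at a unitary base (the chart coordinates of unitary configurations are skew; a symmetry-of-values argument through the continuous linear map `Φ ↦ Φ(b)⋆ + Φ(b)`).
WHAT ([folklore]; 0 def, 0 sorry):
* §1 **`fderiv_fderiv_coord_mem_skewSub`** (every `d`, `L ≥ 1`; `W` unitary `(L·M)`-periodic, `SmallField W x`, `x < x′`, `512(d+1)(d+4)L²x′ ≤ 1`; `ψ ∈ skewSub (L·M)`):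
  `D²coord_W(0)[ψ,ψ] ∈ skewSub M`; `room_of_liftSmall` (`liftSmall·x ≤ 1 ⇒ 512(d+1)(d+4)L²·(2x) ≤ 1`: row NE3-R2's class always has room).
* §2 **`multiplierTerm_base_le`** (`d = 4`; the frame of ✓ `NE7MultiplierDensity`): for every base `W` of depth one (unitary, `(L·N)`-periodic, `SmallField W x`, `0 ≤ x`, `LevelSmall 4 L 0 x`) and
  every `ψ ∈ skewSub (L·N)`: `|Dm(0)[D²(levelQ L N 0 W ∘ chart_W)(0)[ψ,ψ]]| ≤ 2·curl1C 4 L·ε·((4∕rho0 4 L²)·(4·(2·nbRad 4 L+1)^4)·dirSq ψ̃ (periodBox (L·N)))` — NO condition tying `W` to `V₀`.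
* §3 **`multiplierTerm_step_le`** (`d = 4`; the frame of ✓ `NE7MultiplierTailLetter.abs_multiplier_levelQ'_le_dirL1_QbarIter`): for every `k`, every base `W` (unitary, `(tower L N (k+2))`-periodic,
  `SmallField W x`, `0 ≤ x`, `LevelSmall 4 L (k+1) x`) with `cavgIter L (k+2) W = V₀`, and every `ψ ∈ skewSub (L·tower L N (k+1))`:
  `|Dm(0)[D²𝒢_{k+1,W}(0)[ψ,ψ]]| ≤ |Dm(0)[D²𝒢_{k,W̄}(0)[Tψ,Tψ]]| + 2·curl1C 4 L·ε·dirL1 (QbarIter L (k+1) W̄ (extDir (D²coord_W(0)[ψ,ψ]))) (periodBox N)`.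
HONEST FRAMING (page 1): composition of landed kernel theorems; what is NOT here: the `ℓ¹` contraction of the straight tower (`‖Q̄_{m} Y‖_{ℓ¹(top)} ≤ θ^m‖Y‖_{ℓ¹(base)}`, row NE3's majorant
tower ✓ `NE3QbarIterMajorant` summed over a period) and the level masses `dirSq (dirIter i U♯ X̃)` of the lifts on the road's gauge slice (where ✓ `NE7BorderedHessianGaugeDegenerate` lets the
road choose the representative) — together they turn the iterated step into the `j`-uniform bound `|Dm(0)[D²𝒢(0)[X,X]]| ≤ ε·C(L)·η²Σ‖X̃‖²`; nothing of Bałaban's asserted; NOT (G), NOT NE7 as a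
spine node, NOT NE3; row NE7b NOT PRINTED ∕ NOT PROVED; spine 0∕9; finite T⁴ rung (B)+1 — NOT infinite volume, NOT mass gap, NOT BetaPertH, NOT Clay.
-/

set_option autoImplicit false

open scoped BigOperators Matrix Matrix.Norms.L2Operator Topology
open NormedSpace Finset Set Filter Metric

namespace Summit.QuantumFields.BalabanUV.T4Continuum.NE7MultiplierTermRecursion

open Literature.MathematicalPhysics.QuantumFieldTheory.Balaban1983to89
open B7Prop1Explicit B7Prop2Explicit MatrixLog UnitaryModel
open T4AveragingDeficitWall (IsUnitaryCfg IsSkewDir SmallField dirL1 dirSq)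
open T4AveragingDeficitWallBoundary (IsPeriodicCfg periodBox)
open AveragingDeficitPeriodicCounting (IsPeriodicDir)
open AveragingDeficitTorusChart (TDir chart chartDir extDir resDir resDir_extDir isPeriodicDir_extDir isUnitaryCfg_chart)
open AveragingDeficitChartCalculus (cavg coord relLog contDiffAt_coord)
open AveragingDeficitFermat (eventually_smallField_chart small512_of_liftSmall)
open AveragingDeficitFaceLift (liftSmall)
open AveragingDeficitTwoLevelPrep (skewSub mem_skewSub skewPR cavg_isUnitaryCfg smallness_of_twoLevelSmall)
open AveragingDeficitMultiLevelPrep (tower cavgIter levelQ levelQ' LevelSmall natCast_tower_succ)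
open MinimalActionSandwich (IsMinimiser minAct)
open MinimalActionRate (sfClass)
open NE3TangentCovariantTower (QbarIter)
open NE3HatInvCurlLetters (curl1C curl1C_nonneg)
open BlockAverageVaryHolo (nbRad)
open BlockAverageVaryDisc (rho0)
open NE7AdmissibleFibreLHC (chart_id_eq_chart_skewP)
open NE7SecondOrderChainRuleVec (fderiv_fderiv_comp_vec fderiv_fderiv_comp_clm_vec)
open NE7OneStepConstraintCurvature (ball_of_small512)
open NE7ConstraintSecondDerivativeRecursion (fderiv_fderiv_levelQ_chart_zero fderiv_fderiv_levelQ_chart_succ cavg_levelSmall)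
open NE7MultiplierDensity (multiplierTerm_top_le_allData_uniform)
open NE7MultiplierTailLetter (abs_multiplier_levelQ'_le_dirL1_QbarIter)
open B7UnitaryAveragesAllRadii (mlog_mem_skewAdjoint_of_mem_unitary)

noncomputable section

variable {d : ℕ} {n : Type} [Fintype n] [DecidableEq n]

/-! ## §1 The one-step curvature is `𝔲(n)`-valued on skew directions at a unitary base -/

/-- **Row NE3-R2's class always has room**: `liftSmall d L·x ≤ 1` ⇒ `512(d+1)(d+4)L²·(2x) ≤ 1` (`liftSmall = 32768(d+1)(d+4)L^{d+2}`, `L ≥ 1`, `x ≥ 0`). [folklore] -/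
theorem room_of_liftSmall {L : ℕ} (hL : 1 ≤ L) {x : ℝ} (hx : 0 ≤ x) (h : liftSmall d L * x ≤ 1) :
    512 * (d + 1) * (d + 4) * (L : ℝ) ^ 2 * (2 * x) ≤ 1 := by
  have hL1 : (1 : ℝ) ≤ L := by exact_mod_cast hL
  have hL2 : (L : ℝ) ^ 2 ≤ (L : ℝ) ^ (d + 2) := pow_le_pow_right₀ hL1 (by omega)
  have hd : 0 ≤ ((d : ℝ) + 1) * ((d : ℝ) + 4) := by positivity
  unfold liftSmall at h
  have h1 : 512 * (d + 1) * (d + 4) * (L : ℝ) ^ 2 * (2 * x) = 1024 * (((d : ℝ) + 1) * ((d : ℝ) + 4)) * (L : ℝ) ^ 2 * x := by ring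
  rw [h1]
  calc 1024 * (((d : ℝ) + 1) * ((d : ℝ) + 4)) * (L : ℝ) ^ 2 * x
      ≤ 32768 * (((d : ℝ) + 1) * ((d : ℝ) + 4)) * (L : ℝ) ^ (d + 2) * x := by
        have : 0 ≤ (((d : ℝ) + 1) * ((d : ℝ) + 4)) * x := by positivity
        nlinarith [mul_le_mul_of_nonneg_left hL2 this]
    _ = 32768 * ((d : ℝ) + 1) * ((d : ℝ) + 4) * (L : ℝ) ^ (d + 2) * x := by ring
    _ ≤ 1 := h

/-- **THE ONE-STEP CURVATURE IS SKEW ON SKEW DIRECTIONS AT A UNITARY BASE**: for `W` unitary `(L·M)`-periodic with `SmallField W x`, `0 ≤ x < x′`, `512(d+1)(d+4)L²x′ ≤ 1`, and `ψ ∈ skewSub (L·M)`: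
`D²(coord L M W)(0)[ψ,ψ] ∈ skewSub M` (the chart coordinates `log(W̄(b)⁻¹·\overline{W e^{Φ̃}}(b))` of the unitary configurations `chart_W Φ`, `Φ ∈ skewSub` near `0`, are `𝔲(n)`-valued, so the
continuous linear read-out `Φ ↦ Φ(b)⋆ + Φ(b)` vanishes identically on the restriction to `skewSub`, hence on its second derivative). [folklore] -/
theorem fderiv_fderiv_coord_mem_skewSub [Nonempty n] {L M : ℕ} [NeZero M] [NeZero (L * M)] (hL : 1 ≤ L) {W : Site d → Fin d → (Matrix n n ℂ)ˣ}
    {x x' : ℝ} (hWu : IsUnitaryCfg W) (hWP : IsPeriodicCfg W ((L * M : ℕ) : ℤ)) (hx : 0 ≤ x) (hxx' : x < x')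
    (h512' : 512 * (d + 1) * (d + 4) * (L : ℝ) ^ 2 * x' ≤ 1) (hWx : SmallField W x) (ψ : ↥(skewSub d n (L * M))) :
    fderiv ℝ (fderiv ℝ (coord (ContinuousLinearMap.id ℝ (Matrix n n ℂ)) L M W)) 0 (ψ : TDir d n (L * M)) (ψ : TDir d n (L * M)) ∈ skewSub d n M := by
  have hx' : 0 ≤ x' := hx.trans hxx'.le
  have h512 : 512 * (d + 1) * (d + 4) * (L : ℝ) ^ 2 * x ≤ 1 := by
    have : 0 ≤ 512 * ((d : ℝ) + 1) * ((d : ℝ) + 4) * (L : ℝ) ^ 2 := by positivity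
    nlinarith
  set F : TDir d n (L * M) → TDir d n M := coord (ContinuousLinearMap.id ℝ (Matrix n n ℂ)) L M W with hFdef
  have hF : ContDiffAt ℝ 2 F 0 := contDiffAt_coord (m := 2) (ContinuousLinearMap.id ℝ (Matrix n n ℂ)) L M W (ball_of_small512 hL hWu hx h512 hWx)
  refine mem_skewSub.mpr fun y κ => ?_
  -- the continuous linear read-out `h Φ = Φ(y,κ)⋆ + Φ(y,κ)`
  set π : TDir d n M →L[ℝ] Matrix n n ℂ :=
    (ContinuousLinearMap.proj κ).comp (ContinuousLinearMap.proj (R := ℝ) (φ := fun _ : Fin d → Fin M => Fin d → Matrix n n ℂ) y) with hπ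
  set g : Matrix n n ℂ →L[ℝ] Matrix n n ℂ := ((starL' ℝ : Matrix n n ℂ ≃L[ℝ] Matrix n n ℂ) : Matrix n n ℂ →L[ℝ] Matrix n n ℂ) + ContinuousLinearMap.id ℝ (Matrix n n ℂ) with hg
  set h : TDir d n M →L[ℝ] Matrix n n ℂ := g.comp π with hh
  have happ : ∀ Φ : TDir d n M, h Φ = star (Φ y κ) + Φ y κ := fun Φ => by
    simp [hh, hg, hπ]
  -- (1) `D²(h ∘ F ∘ ι)(0)[ψ,ψ] = h (D²F(0)[ψ,ψ])`
  have hι0 : ((skewSub d n (L * M)).subtypeL (0 : ↥(skewSub d n (L * M))) : TDir d n (L * M)) = 0 := by simp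
  have hhF : ContDiffAt ℝ 2 (fun Φ : TDir d n (L * M) => h (F Φ)) 0 := h.contDiff.contDiffAt.comp 0 hF
  have e1 : fderiv ℝ (fderiv ℝ (fun Φ : ↥(skewSub d n (L * M)) => h (F (Φ : TDir d n (L * M))))) 0 ψ ψ
      = h (fderiv ℝ (fderiv ℝ F) 0 (ψ : TDir d n (L * M)) (ψ : TDir d n (L * M))) := by
    have hhF' : ContDiffAt ℝ 2 (fun Φ : TDir d n (L * M) => h (F Φ)) ((skewSub d n (L * M)).subtypeL (0 : ↥(skewSub d n (L * M)))) := by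
      rw [hι0]; exact hhF
    have s1 : fderiv ℝ (fderiv ℝ (fun Φ : ↥(skewSub d n (L * M)) => h (F (Φ : TDir d n (L * M))))) 0 ψ ψ
        = fderiv ℝ (fderiv ℝ (fun Φ : TDir d n (L * M) => h (F Φ))) ((skewSub d n (L * M)).subtypeL (0 : ↥(skewSub d n (L * M))))
          ((skewSub d n (L * M)).subtypeL ψ) ((skewSub d n (L * M)).subtypeL ψ) :=
      fderiv_fderiv_comp_clm_vec (f := fun Φ : TDir d n (L * M) => h (F Φ)) ((skewSub d n (L * M)).subtypeL)
        (x := (0 : ↥(skewSub d n (L * M)))) hhF' ψ ψ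
    rw [s1, hι0, Submodule.subtypeL_apply]
    have s2 := fderiv_fderiv_comp_vec (f := fun Y : TDir d n M => h Y) (Θ := F) (x := (0 : TDir d n (L * M))) h.contDiff.contDiffAt hF
      (ψ : TDir d n (L * M)) (ψ : TDir d n (L * M))
    have hD1 : fderiv ℝ (fun Y : TDir d n M => h Y) = fun _ => h := by funext Y; exact h.fderiv
    have hD2 : fderiv ℝ (fderiv ℝ (fun Y : TDir d n M => h Y)) (F 0) = 0 := by rw [hD1, fderiv_const_apply]
    rw [hD2, hD1] at s2
    simpa only [zero_apply, zero_add] using s2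
  -- (2) `h ∘ F ∘ ι` vanishes near `0`: the chart coordinates of unitary configurations are skew
  have hsf : ∀ᶠ Φ : ↥(skewSub d n (L * M)) in 𝓝 0, SmallField (chart (ContinuousLinearMap.id ℝ (Matrix n n ℂ)) (L * M) W (Φ : TDir d n (L * M))) x' := by
    have hev := eventually_smallField_chart (ContinuousLinearMap.id ℝ (Matrix n n ℂ)) (L * M) hWP hxx' hWx
    have ht : Tendsto (fun Φ : ↥(skewSub d n (L * M)) => (Φ : TDir d n (L * M))) (𝓝 0) (𝓝 0) := by
      have hc := (skewSub d n (L * M)).subtypeL.continuous.tendsto (0 : ↥(skewSub d n (L * M)))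
      rwa [hι0] at hc
    exact ht.eventually hev
  have e2 : (fun Φ : ↥(skewSub d n (L * M)) => h (F (Φ : TDir d n (L * M)))) =ᶠ[𝓝 0] fun _ => 0 := by
    filter_upwards [hsf] with Φ hΦ
    have hUu : IsUnitaryCfg (chart (ContinuousLinearMap.id ℝ (Matrix n n ℂ)) (L * M) W (Φ : TDir d n (L * M))) := by
      rw [chart_id_eq_chart_skewP W Φ.2]; exact isUnitaryCfg_chart (L * M) hWu _
    have hA : IsUnitaryCfg (cavg L W) := cavg_isUnitaryCfg hL hWu hx h512 hWx
    have hB : IsUnitaryCfg (cavg L (chart (ContinuousLinearMap.id ℝ (Matrix n n ℂ)) (L * M) W (Φ : TDir d n (L * M)))) := cavg_isUnitaryCfg hL hUu hx' h512' hΦ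
    have hunit : ((((cavg L W (boxVec M y) κ)⁻¹ : (Matrix n n ℂ)ˣ) : Matrix n n ℂ)
        * ((cavg L (chart (ContinuousLinearMap.id ℝ (Matrix n n ℂ)) (L * M) W (Φ : TDir d n (L * M))) (boxVec M y) κ : (Matrix n n ℂ)ˣ) : Matrix n n ℂ))
          ∈ unitary (Matrix n n ℂ) := by
      rw [← Units.val_mul]
      exact (mem_unitaryUnits).mp ((unitaryUnits (Matrix n n ℂ)).mul_mem ((unitaryUnits (Matrix n n ℂ)).inv_mem (hA _ _)) (hB _ _))
    have hskew := mlog_mem_skewAdjoint_of_mem_unitary hunit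
    rw [happ]
    have hval : F (Φ : TDir d n (L * M)) y κ = mlog ((((cavg L W (boxVec M y) κ)⁻¹ : (Matrix n n ℂ)ˣ) : Matrix n n ℂ)
        * ((cavg L (chart (ContinuousLinearMap.id ℝ (Matrix n n ℂ)) (L * M) W (Φ : TDir d n (L * M))) (boxVec M y) κ : (Matrix n n ℂ)ˣ) : Matrix n n ℂ)) := rfl
    rw [hval, (skewAdjoint.mem_iff.mp hskew), neg_add_cancel]
  -- (3) conclude
  have e3 : fderiv ℝ (fderiv ℝ (fun Φ : ↥(skewSub d n (L * M)) => h (F (Φ : TDir d n (L * M))))) 0 ψ ψ = 0 := by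
    rw [(e2.fderiv (𝕜 := ℝ)).fderiv_eq (𝕜 := ℝ)]
    simp
  rw [e1, happ] at e3
  exact skewAdjoint.mem_iff.mpr (eq_neg_of_add_eq_zero_left e3)

/-! ## §2 The base of the tower: depth one -/

/-- **THE MULTIPLIER TERM AT DEPTH ONE** (`d = 4`, every `U(n)`, `L ≥ 2`; the frame of ✓ `NE7MultiplierDensity.multiplierTerm_top_le_allData_uniform`): for every base `W` of depth one
(unitary, `(L·N)`-periodic, `SmallField W x`, `0 ≤ x`, `LevelSmall 4 L 0 x`) and every `ψ ∈ TDir (L·N)`: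
`|Dm(0)[D²(levelQ L N 0 W ∘ chart_W)(0)[ψ,ψ]]| ≤ 2·curl1C 4 L·ε·((4∕rho0 4 L²)·(4·(2·nbRad 4 L+1)^4)·dirSq ψ̃ (periodBox (L·N)))`. [folklore] -/
theorem multiplierTerm_base_le [Nonempty n] {L : ℕ} [NeZero L] (hL : 2 ≤ L) :
    ∃ ε₀ : ℝ, 0 < ε₀ ∧ ∀ ε : ℝ, 0 < ε → ε ≤ ε₀ → ∀ (N : ℕ) [NeZero N], 1 ≤ N → ∃ δV : ℝ, 0 < δV ∧ ∀ j : ℕ,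
        ∀ V₀ ∈ {V : Site 4 → Fin 4 → (Matrix n n ℂ)ˣ | IsUnitaryCfg V ∧ IsPeriodicCfg V (N : ℤ) ∧ SmallField V δV},
        ∀ Us : Site 4 → Fin 4 → (Matrix n n ℂ)ˣ, IsMinimiser 4 (sfClass 4 L N ε) L N (j + 1) V₀ Us →
        ∀ (W : Site 4 → Fin 4 → (Matrix n n ℂ)ˣ) (x : ℝ), IsUnitaryCfg W → 0 ≤ x → LevelSmall 4 L 0 x → SmallField W x →
        ∀ ψ : TDir 4 n (L * tower L N 0),
          |fderiv ℝ (fun y : ↥(skewSub 4 n N) => minAct 4 (sfClass 4 L N ε) L N (j + 1) (chart (ContinuousLinearMap.id ℝ (Matrix n n ℂ)) N V₀ (y : TDir 4 n N))) 0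
              (fderiv ℝ (fderiv ℝ (fun Φ : TDir 4 n (L * tower L N 0) =>
                levelQ L N 0 W (chart (ContinuousLinearMap.id ℝ (Matrix n n ℂ)) (L * tower L N 0) W Φ))) 0 ψ ψ)|
            ≤ 2 * curl1C 4 L * ε * (4 / rho0 4 L ^ 2 * ((4 : ℕ) * (2 * nbRad 4 L + 1) ^ 4)
                * dirSq (chartDir (ContinuousLinearMap.id ℝ (Matrix n n ℂ)) (L * N) ψ) (periodBox (d := 4) (L * N))) := by
  obtain ⟨ε₀, hε₀, H⟩ := multiplierTerm_top_le_allData_uniform (n := n) hL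
  have hL1 : 1 ≤ L := le_trans (by norm_num) hL
  refine ⟨ε₀, hε₀, fun ε hε hεle N _ hN => ?_⟩
  obtain ⟨δV, hδV, H1⟩ := H ε hε hεle N hN
  refine ⟨δV, hδV, fun j V₀ hV₀ Us hUs W x hWu hx hs hWx ψ => ?_⟩
  obtain ⟨hlift, -, -, -⟩ := smallness_of_twoLevelSmall (d := 4) hL1 hx hs
  have h512 := small512_of_liftSmall hL1 hx hlift
  have hsmall : 512 * (4 + 1) * (4 + 4) * (L : ℝ) ^ 2 * x ≤ 1 := by
    have e : (512 * (4 + 1) * (4 + 4) * (L : ℝ) ^ 2 * x) = 512 * ((4 : ℕ) + 1 : ℝ) * ((4 : ℕ) + 4) * (L : ℝ) ^ 2 * x := by push_cast; ring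
    rw [e]; exact h512
  rw [fderiv_fderiv_levelQ_chart_zero (M' := N) hL1 hWu hx hs hWx ψ ψ]
  exact H1 j V₀ hV₀ Us hUs W x hWu hx hsmall hWx ψ

/-! ## §3 The step of the tower -/

/-- **THE MULTIPLIER TERM: ONE STEP DOWN THE TOWER** (`d = 4`, every `U(n)`, `L ≥ 2`; the frame of ✓ `NE7MultiplierTailLetter.abs_multiplier_levelQ'_le_dirL1_QbarIter`): for every `k`, every
base `W` (unitary, `(tower L N (k+2))`-periodic, `SmallField W x`, `0 ≤ x`, `LevelSmall 4 L (k+1) x`) whose `(k+2)`-fold average is the datum `V₀`, and every `ψ ∈ skewSub (L·tower L N (k+1))`,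
with `W̄ = cavg L W`, `T = D coord_W(0)`, `c = D²coord_W(0)[ψ,ψ]`:
`|Dm(0)[D²(levelQ L N (k+1) W ∘ chart_W)(0)[ψ,ψ]]| ≤ |Dm(0)[D²(levelQ L N k W̄ ∘ chart_W̄)(0)[Tψ,Tψ]]| + 2·curl1C 4 L·ε·dirL1 (QbarIter L (k+1) W̄ (extDir (L·tower L N k) c)) (periodBox N)`.
[folklore] -/
theorem multiplierTerm_step_le [Nonempty n] {L : ℕ} [NeZero L] (hL : 2 ≤ L) :
    ∃ ε₀ : ℝ, 0 < ε₀ ∧ ∀ ε : ℝ, 0 < ε → ε ≤ ε₀ → ∀ (N : ℕ) [NeZero N], 1 ≤ N → ∃ δV : ℝ, 0 < δV ∧ ∀ j : ℕ,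
        ∀ V₀ ∈ {V : Site 4 → Fin 4 → (Matrix n n ℂ)ˣ | IsUnitaryCfg V ∧ IsPeriodicCfg V (N : ℤ) ∧ SmallField V δV},
        ∀ Us : Site 4 → Fin 4 → (Matrix n n ℂ)ˣ, IsMinimiser 4 (sfClass 4 L N ε) L N (j + 1) V₀ Us →
        ∀ (k : ℕ) (W : Site 4 → Fin 4 → (Matrix n n ℂ)ˣ) (x : ℝ), IsUnitaryCfg W → IsPeriodicCfg W ((tower L N (k + 2) : ℕ) : ℤ) → 0 ≤ x →
          LevelSmall 4 L (k + 1) x → SmallField W x → cavgIter L (k + 2) W = V₀ →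
        ∀ ψ : ↥(skewSub 4 n (L * tower L N (k + 1))),
          |fderiv ℝ (fun y : ↥(skewSub 4 n N) => minAct 4 (sfClass 4 L N ε) L N (j + 1) (chart (ContinuousLinearMap.id ℝ (Matrix n n ℂ)) N V₀ (y : TDir 4 n N))) 0
              (fderiv ℝ (fderiv ℝ (fun Φ : TDir 4 n (L * tower L N (k + 1)) =>
                levelQ L N (k + 1) W (chart (ContinuousLinearMap.id ℝ (Matrix n n ℂ)) (L * tower L N (k + 1)) W Φ))) 0
                (ψ : TDir 4 n (L * tower L N (k + 1))) (ψ : TDir 4 n (L * tower L N (k + 1))))|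
            ≤ |fderiv ℝ (fun y : ↥(skewSub 4 n N) => minAct 4 (sfClass 4 L N ε) L N (j + 1) (chart (ContinuousLinearMap.id ℝ (Matrix n n ℂ)) N V₀ (y : TDir 4 n N))) 0
                (fderiv ℝ (fderiv ℝ (fun Φ' : TDir 4 n (L * tower L N k) =>
                  levelQ L N k (cavg L W) (chart (ContinuousLinearMap.id ℝ (Matrix n n ℂ)) (L * tower L N k) (cavg L W) Φ'))) 0
                  (fderiv ℝ (coord (ContinuousLinearMap.id ℝ (Matrix n n ℂ)) L (L * tower L N k) W) 0 (ψ : TDir 4 n (L * tower L N (k + 1))))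
                  (fderiv ℝ (coord (ContinuousLinearMap.id ℝ (Matrix n n ℂ)) L (L * tower L N k) W) 0 (ψ : TDir 4 n (L * tower L N (k + 1)))))|
              + 2 * curl1C 4 L * ε * dirL1 (QbarIter L (k + 1) (cavg L W)
                  (extDir (L * tower L N k) (fderiv ℝ (fderiv ℝ (coord (ContinuousLinearMap.id ℝ (Matrix n n ℂ)) L (L * tower L N k) W)) 0
                    (ψ : TDir 4 n (L * tower L N (k + 1))) (ψ : TDir 4 n (L * tower L N (k + 1)))))) (periodBox (d := 4) N) := by
  obtain ⟨ε₀, hε₀, H⟩ := abs_multiplier_levelQ'_le_dirL1_QbarIter (n := n) hL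
  have hL1 : 1 ≤ L := le_trans (by norm_num) hL
  refine ⟨ε₀, hε₀, fun ε hε hεle N _ hN => ?_⟩
  obtain ⟨δV, hδV, H1⟩ := H ε hε hεle N hN
  refine ⟨δV, hδV, fun j V₀ hV₀ Us hUs k W x hWu hWP hx hs hWx htop ψ => ?_⟩
  -- the base, one level up, is again in the class, with room
  have hWP' : IsPeriodicCfg W ((L : ℤ) * (tower L N (k + 1) : ℕ)) := by rw [← natCast_tower_succ]; exact hWP
  obtain ⟨x', hx', hs', hWu', hWbP, hWx', hball⟩ := cavg_levelSmall (M' := N) hL1 k hWu hWP' hx hs hWx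
  have hWbP' : IsPeriodicCfg (cavg L W) ((tower L N (k + 1) : ℕ) : ℤ) := by rw [natCast_tower_succ]; exact hWbP
  have htop' : cavgIter L (k + 1) (cavg L W) = V₀ := htop
  -- the one-step curvature at the base is skew and periodic
  obtain ⟨hlift, -, -, -⟩ := smallness_of_twoLevelSmall (d := 4) hL1 hx hs.1
  have hroom := room_of_liftSmall (d := 4) hL1 hx hlift
  have hxx : x < 2 * x ∨ x = 0 := by
    rcases eq_or_lt_of_le hx with h0 | hpos
    · exact Or.inr h0.symm
    · exact Or.inl (by linarith)
  set c : TDir 4 n (L * tower L N k) := fderiv ℝ (fderiv ℝ (coord (ContinuousLinearMap.id ℝ (Matrix n n ℂ)) L (L * tower L N k) W)) 0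
      (ψ : TDir 4 n (L * tower L N (k + 1))) (ψ : TDir 4 n (L * tower L N (k + 1))) with hc
  have hcskew : c ∈ skewSub 4 n (L * tower L N k) := by
    have hWPc : IsPeriodicCfg W ((L * (L * tower L N k) : ℕ) : ℤ) := hWP
    rcases hxx with hlt | h0
    · exact fderiv_fderiv_coord_mem_skewSub (M := L * tower L N k) hL1 hWu hWPc hx hlt hroom hWx ψ
    · -- degenerate radius `x = 0`: use the room `0 < 1`-type bound with `x′ = 2·0 + something`; take `x′ := 1∕(512·5·8·L²)`
      have hpos : (0 : ℝ) < 1 / (512 * (4 + 1) * (4 + 4) * (L : ℝ) ^ 2) := by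
        have : (0 : ℝ) < L := by exact_mod_cast (show 0 < L by omega)
        positivity
      have hle : 512 * (4 + 1) * (4 + 4) * (L : ℝ) ^ 2 * (1 / (512 * (4 + 1) * (4 + 4) * (L : ℝ) ^ 2)) ≤ 1 := by
        have : (0 : ℝ) < L := by exact_mod_cast (show 0 < L by omega)
        rw [mul_one_div, div_self (by positivity)]
      have hle' : 512 * ((4 : ℕ) + 1 : ℝ) * ((4 : ℕ) + 4) * (L : ℝ) ^ 2 * (1 / (512 * (4 + 1) * (4 + 4) * (L : ℝ) ^ 2)) ≤ 1 := by push_cast; linarith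
      exact fderiv_fderiv_coord_mem_skewSub (M := L * tower L N k) hL1 hWu hWPc hx (by rw [h0]; exact hpos) hle' hWx ψ
  have hYs : IsSkewDir (extDir (L * tower L N k) c) := fun z μ => (mem_skewSub.mp hcskew) _ _
  have hYP : IsPeriodicDir (extDir (L * tower L N k) c) ((tower L N (k + 1) : ℕ) : ℤ) := isPeriodicDir_extDir (L * tower L N k) c
  -- the recursion and the tail letter
  rw [fderiv_fderiv_levelQ_chart_succ (M' := N) hL1 k hWu hWP' hx hs hWx, map_add]
  refine (abs_add_le _ _).trans (add_le_add le_rfl ?_)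
  have htail := H1 j V₀ hV₀ Us hUs k (cavg L W) x' hWu' hWbP' hx' hs' hWx' htop' (extDir (L * tower L N k) c) hYs hYP
  rw [resDir_extDir] at htail
  exact htail

end

end Summit.QuantumFields.BalabanUV.T4Continuum.NE7MultiplierTermRecursion
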